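import Summits.NavierStokesRegularity.NavierStokesRegularity.Theses.ExtremalTypeIConstant
import Summits.NavierStokesRegularity.NavierStokesRegularity.Theorems.ExtremalTypeIConstantTargetOfCruxes
import HarnessLib

/-!
# Route `ExtremalTypeIConstant` — the assembly (item stmt-NavierStokesRegularity-8223)

Theorems file closing the assembly item `stmt-NavierStokesRegularity-8223`
(`Summit.NavierStokesRegularity.NavierStokesRegularity.Theses.ExtremalTypeIConstant.Assembly`) of
route `ExtremalTypeIConstant` for `NavierStokesRegularity` (Clay A), proved against the route decl
itself (this module imports the route file).

The assembly is PURE LOGIC over the route's items, all taken as hypotheses of the `Assembly` Prop: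
`ExtremalSpiralSymmetry → SpiralScalingLiouville → MinimiserExists → LiouvilleKillsTypeI → NoTypeII →
NoBlowupToClay → NavierStokesRegularity`.

Proof: the first three hypotheses give the Liouville statement `X = TypeIAncientLiouville` (every
element of the Type-I KNSS-mild ancient class `A_C` vanishes on `t < 0`) — this is exactly the
already-settled support item `TargetOfCruxes`
(`extremalTypeIConstant_targetOfCruxes_proof`: a nontrivial element yields an extremal pair
`(C₀, w)` with `0 < C₀ = ‖w(−1,0)‖` by `MinimiserExists`, `ExtremalSpiralSymmetry` gives its
spiral-scaling symmetry, `SpiralScalingLiouville` forces `w(−1,0) = 0`, contradiction).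
`NoBlowupToClay` reduces the summit statement to continuation past every `T > 0` of every
finite-energy classical solution from a rapidly decaying datum; if such a solution on `[0, T)` had no
smooth extension past `T` it would be maximal (`IsMaximalSmoothSolution` is by definition
`classical ∧ ¬ extension`), hence Type I by `NoTypeII`, hence extendable by `LiouvilleKillsTypeI`
fed with `X` — contradiction.

References: Koch–Nadirashvili–Seregin–Šverák 2009 (arXiv:0709.3599 §6, Prop. 6.1); Fefferman 2000
(Clay statement). No analysis is performed here; every analytic input is an explicit hypothesis of
`Assembly`.
-/

set_option linter.dupNamespace false -- nested layout Summit.<S>.<Sub>, Sub = S (D-0017)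

namespace Summit.NavierStokesRegularity.NavierStokesRegularity.Theorems

open Summit.NavierStokesRegularity.NavierStokesRegularity.Theses.ExtremalTypeIConstant

/-- **Assembly of route `ExtremalTypeIConstant`** (item stmt-NavierStokesRegularity-8223; the type
is literally the route decl `Assembly`):
`ExtremalSpiralSymmetry → SpiralScalingLiouville → MinimiserExists → LiouvilleKillsTypeI → NoTypeII →
NoBlowupToClay → NavierStokesRegularity` composes by pure logic. The three cruxes give the Liouville
statement `X = TypeIAncientLiouville` (support item `TargetOfCruxes`); a classical Leray–Hopf
solution from a rapidly decaying datum with no smooth extension past `T` is maximal, hence Type I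
(`NoTypeII`), hence extends (`LiouvilleKillsTypeI` with `X`) — contradiction; `NoBlowupToClay`
turns continuation past every `T` into Clay (A). [sources: KNSS2009 = arXiv:0709.3599 §6;
Fefferman2000] -/
theorem extremalTypeIConstant_assembly_proof :
    Summit.NavierStokesRegularity.NavierStokesRegularity.Theses.ExtremalTypeIConstant.Assembly := by
  unfold Assembly
  intro hSym hLiou hMin hKill hNoII hClay
  -- Step 1: the Liouville statement `X` from the three cruxes (support item `TargetOfCruxes`).
  have hX : TypeIAncientLiouville := extremalTypeIConstant_targetOfCruxes_proof hSym hLiou hMin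
  -- Step 2: Clay (A) from continuation past every `T`; continuation by contradiction.
  refine hClay ?_
  intro ν T hν hT u p hcl hLH hdec
  by_contra hne
  exact hne (hKill hX ν T hν hT u p hcl hLH hdec (hNoII ν T hν hT u p ⟨hcl, hne⟩ hLH hdec))

end Summit.NavierStokesRegularity.NavierStokesRegularity.Theorems
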